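import Literature.Analysis.Asymptotics.WidderAbelianLaplace

/-!
# Proof of Widder's Abelian theorem for the Laplace transform (discharge of the named fact)

This file discharges the named fact
`Literature.Analysis.Asymptotics.Widder1941_abelian_laplace` (Widder 1941, Ch. V §1, Theorem 1,
display (2), with Corollary 1a; signed absolutely continuous case) stated in
`Literature/Analysis/Asymptotics/WidderAbelianLaplace.lean`, by the theorem
`Widder1941_abelian_laplace_holds`, following Widder's printed proof (pp. 180–181):

* (i) `f(s) = s ∫₀^∞ e^{-st} α(t) dt` — Widder's Theorem II.2.3a; in the absolutely continuous
  case `α(t) = ∫_{(0,t]} a` this is Fubini on `{0 < u ≤ t} ⊂ (0,∞)²` for the absolutely integrable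
  kernel `e^{-st} a(u)` (`wal_fubini`);
* (ii) the Euler integral `∫₀^∞ e^{-st} t^γ dt = Γ(γ+1)/s^{γ+1}` (`wal_gamma_integral`), whence
  Widder's identity `s^γ f(s) − A = (s^{γ+1}/Γ(γ+1)) ∫₀^∞ e^{-st} [Γ(γ+1) α(t) − A t^γ] dt`;
* (iii) the split of this integral at a large `T`: on `(0,T]` the bracket is bounded by
  `C = Γ(γ+1) ∫_{(0,T]} |a| + |A| T^γ`, contributing `≤ s^{γ+1} C T/Γ(γ+1) → 0`, and on `(T,∞)` it
  is `≤ η t^γ`, contributing `≤ η` (Widder's display (4) and the last display of the proof).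

No new definitions or named facts; helper lemmas are private and proved here.

## References
* [Widder1941] D. V. Widder, The Laplace Transform, Princeton Univ. Press (1941), Ch. V §1,
  Theorem 1 and Corollary 1a, pp. 180–181; Ch. II §2, Theorem 2.3a.
-/

noncomputable section

open MeasureTheory Filter Set
open scoped Topology

namespace Literature.Analysis.Asymptotics

/-- `∫_{(u,∞)} e^{-st} dt = e^{-su}/s` for `s > 0`. [folklore] -/
private theorem wal_integral_exp {s : ℝ} (hs : 0 < s) (u : ℝ) :
    ∫ t in Ioi u, Real.exp (-(s * t)) = Real.exp (-(s * u)) / s := by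
  have h := integral_exp_mul_Ioi (neg_lt_zero.mpr hs) u
  simp only [neg_mul] at h
  rw [h, neg_div_neg_eq]

/-- `t ↦ e^{-st}` is integrable on every `(c, ∞)` for `s > 0`. [folklore] -/
private theorem wal_exp_integrableOn {s : ℝ} (hs : 0 < s) (c : ℝ) :
    IntegrableOn (fun t : ℝ => Real.exp (-(s * t))) (Ioi c) := by
  simpa only [neg_mul] using exp_neg_integrableOn_Ioi c hs

/-- The `t`-section integral of the Fubini kernel: for `u > 0`,
`∫_{t>0} 1_{u ≤ t} e^{-st} c dt = c e^{-su}/s`. [folklore] -/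
private theorem wal_inner {s : ℝ} (hs : 0 < s) {u : ℝ} (hu : 0 < u) (c : ℝ) :
    ∫ t in Ioi 0, (Ici u).indicator (fun t => Real.exp (-(s * t)) * c) t =
      c * (Real.exp (-(s * u)) / s) := by
  rw [setIntegral_indicator measurableSet_Ici, inter_eq_right.mpr (Ici_subset_Ioi.mpr hu),
    integral_Ici_eq_integral_Ioi, integral_mul_const, wal_integral_exp hs u]
  ring

/-- **Widder's Theorem II.2.3a in the absolutely continuous case** (by Fubini): if `a` is
a.e.-strongly measurable on `(0,∞)` and `e^{-st} a(t)` is integrable there (`s > 0`), then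
`t ↦ e^{-st} ∫_{(0,t]} a` is integrable on `(0,∞)` and
`∫₀^∞ e^{-st} a(t) dt = s ∫₀^∞ e^{-st} (∫_{(0,t]} a) dt`. [folklore] -/
private theorem wal_fubini {a : ℝ → ℝ} {s : ℝ} (hs : 0 < s)
    (ha : AEStronglyMeasurable a (volume.restrict (Ioi 0)))
    (hint : IntegrableOn (fun t => Real.exp (-(s * t)) * a t) (Ioi 0)) :
    IntegrableOn (fun t => Real.exp (-(s * t)) * ∫ u in Ioc 0 t, a u) (Ioi 0) ∧
      ∫ t in Ioi 0, Real.exp (-(s * t)) * a t =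
        s * ∫ t in Ioi 0, Real.exp (-(s * t)) * ∫ u in Ioc 0 t, a u := by
  -- the kernel `F (u, t) = 1_{u ≤ t} e^{-st} a(u)` on `(0,∞) × (0,∞)`
  obtain ⟨F, hF⟩ : ∃ F : ℝ × ℝ → ℝ,
      F = {p : ℝ × ℝ | p.1 ≤ p.2}.indicator (fun p => Real.exp (-(s * p.2)) * a p.1) :=
    ⟨_, rfl⟩
  have hsec_u : ∀ u, (fun t => F (u, t)) =
      (Ici u).indicator fun t => Real.exp (-(s * t)) * a u := by
    intro u; funext t
    simp only [hF, Set.indicator_apply, mem_setOf_eq, mem_Ici]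
  have hsec_t : ∀ t, (fun u => F (u, t)) =
      (Iic t).indicator fun u => Real.exp (-(s * t)) * a u := by
    intro t; funext u
    simp only [hF, Set.indicator_apply, mem_setOf_eq, mem_Iic]
  have hnorm_u : ∀ u, (fun t => ‖F (u, t)‖) =
      (Ici u).indicator fun t => Real.exp (-(s * t)) * |a u| := by
    intro u; funext t
    simp only [hF, Set.indicator_apply, mem_setOf_eq, mem_Ici]
    split_ifs <;> simp
  have hinner_t : ∀ t, ∫ u in Ioi 0, F (u, t) = Real.exp (-(s * t)) * ∫ u in Ioc 0 t, a u := by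
    intro t
    rw [hsec_t t, setIntegral_indicator measurableSet_Iic, Ioi_inter_Iic, integral_const_mul]
  -- measurability on the product
  have hFmeas : AEStronglyMeasurable F
      ((volume.restrict (Ioi (0 : ℝ))).prod (volume.restrict (Ioi (0 : ℝ)))) := by
    have h1 : AEStronglyMeasurable (fun p : ℝ × ℝ => Real.exp (-(s * p.2)))
        ((volume.restrict (Ioi (0 : ℝ))).prod (volume.restrict (Ioi (0 : ℝ)))) :=
      (by fun_prop : Continuous fun p : ℝ × ℝ => Real.exp (-(s * p.2))).aestronglyMeasurable
    have h2 : AEStronglyMeasurable (fun p : ℝ × ℝ => a p.1)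
        ((volume.restrict (Ioi (0 : ℝ))).prod (volume.restrict (Ioi (0 : ℝ)))) := ha.comp_fst
    rw [hF]
    exact (h1.mul h2).indicator measurableSet_le'
  -- integrability on the product (Tonelli on the absolute value)
  have hFint : Integrable F
      ((volume.restrict (Ioi (0 : ℝ))).prod (volume.restrict (Ioi (0 : ℝ)))) := by
    rw [integrable_prod_iff hFmeas]
    refine ⟨Eventually.of_forall fun u => ?_, ?_⟩
    · rw [hsec_u u]
      exact ((wal_exp_integrableOn hs 0).mul_const (a u)).indicator measurableSet_Ici
    · have heq : (fun u => ∫ t in Ioi 0, ‖F (u, t)‖) =ᵐ[volume.restrict (Ioi 0)]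
          fun u => |a u| * (Real.exp (-(s * u)) / s) := by
        refine (ae_restrict_mem measurableSet_Ioi).mono fun u hu => ?_
        show ∫ t in Ioi 0, ‖F (u, t)‖ = |a u| * (Real.exp (-(s * u)) / s)
        rw [hnorm_u u]
        exact wal_inner hs hu |a u|
      refine Integrable.congr ?_ heq.symm
      have h3 : Integrable (fun u => ‖Real.exp (-(s * u)) * a u‖ * (1 / s))
          (volume.restrict (Ioi 0)) := hint.norm.mul_const _
      refine h3.congr (Eventually.of_forall fun u => ?_)
      show ‖Real.exp (-(s * u)) * a u‖ * (1 / s) = |a u| * (Real.exp (-(s * u)) / s)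
      rw [norm_mul, Real.norm_eq_abs, Real.norm_eq_abs, abs_of_pos (Real.exp_pos _)]
      ring
  refine ⟨?_, ?_⟩
  · exact hFint.integral_prod_right.congr (Eventually.of_forall hinner_t)
  · have hswap : ∫ u in Ioi 0, ∫ t in Ioi 0, F (u, t) = ∫ t in Ioi 0, ∫ u in Ioi 0, F (u, t) :=
      (integral_prod F hFint).symm.trans (integral_prod_symm F hFint)
    have hL : ∫ u in Ioi 0, ∫ t in Ioi 0, F (u, t) =
        s⁻¹ * ∫ u in Ioi 0, Real.exp (-(s * u)) * a u := by
      rw [← integral_const_mul]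
      refine setIntegral_congr_fun measurableSet_Ioi fun u hu => ?_
      show ∫ t in Ioi 0, F (u, t) = s⁻¹ * (Real.exp (-(s * u)) * a u)
      rw [hsec_u u, wal_inner hs hu (a u)]
      ring
    have hR : ∫ t in Ioi 0, ∫ u in Ioi 0, F (u, t) =
        ∫ t in Ioi 0, Real.exp (-(s * t)) * ∫ u in Ioc 0 t, a u :=
      integral_congr_ae (Eventually.of_forall hinner_t)
    rw [hL, hR] at hswap
    rw [← hswap, ← mul_assoc, mul_inv_cancel₀ hs.ne', one_mul]

/-- Euler's integral with a rate: `∫₀^∞ e^{-st} t^γ dt = Γ(γ+1)/s^{γ+1}` (`γ + 1 > 0`, `s > 0`).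
[folklore] -/
private theorem wal_gamma_integral {γ s : ℝ} (hγ1 : 0 < γ + 1) (hs : 0 < s) :
    ∫ t in Ioi 0, Real.exp (-(s * t)) * t ^ γ = Real.Gamma (γ + 1) / s ^ (γ + 1) := by
  have h := Real.integral_rpow_mul_exp_neg_mul_Ioi hγ1 hs
  rw [add_sub_cancel_right] at h
  rw [show (fun t : ℝ => Real.exp (-(s * t)) * t ^ γ) = fun t => t ^ γ * Real.exp (-(s * t)) from
      funext fun t => mul_comm _ _, h, one_div, Real.inv_rpow hs.le, div_eq_inv_mul]

/-- The Euler integrand `e^{-st} t^γ` is integrable on `(0,∞)` (`γ + 1 > 0`, `s > 0`). [folklore] -/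
private theorem wal_gamma_integrableOn {γ s : ℝ} (hγ1 : 0 < γ + 1) (hs : 0 < s) :
    IntegrableOn (fun t : ℝ => Real.exp (-(s * t)) * t ^ γ) (Ioi 0) := by
  refine Integrable.of_integral_ne_zero ?_
  rw [wal_gamma_integral hγ1 hs]
  exact (div_pos (Real.Gamma_pos_of_pos hγ1) (Real.rpow_pos_of_pos hs _)).ne'

/-- **Discharge of `Widder1941_abelian_laplace`** (Widder 1941, Ch. V §1, Theorem 1, display (2),
with Corollary 1a), following the printed proof: `f(s) = s ∫ e^{-st} α`, the Euler integral, and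
the split of `s^{γ+1} ∫ e^{-st} [Γ(γ+1)α(t) − A t^γ] dt` at a large `T`.
[cite: Widder1941, Ch. V §1 Theorem 1 and Corollary 1a] -/
theorem Widder1941_abelian_laplace_holds : Widder1941_abelian_laplace := by
  intro a γ A hγ hloc hint hlim
  have hγ1 : 0 < γ + 1 := by linarith
  obtain ⟨G, hG_eq⟩ : ∃ G : ℝ, Real.Gamma (γ + 1) = G := ⟨_, rfl⟩
  have hG : 0 < G := hG_eq ▸ Real.Gamma_pos_of_pos hγ1
  rw [hG_eq] at hlim
  -- the bracket `β(t) = Γ(γ+1) α(t) − A t^γ`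
  obtain ⟨β, hβ⟩ : ∃ β : ℝ → ℝ, ∀ t, β t = G * (∫ u in Ioc 0 t, a u) - A * t ^ γ :=
    ⟨fun t => G * (∫ u in Ioc 0 t, a u) - A * t ^ γ, fun _ => rfl⟩
  -- measurability of `a` on `(0, ∞)` (from the `s = 1` Laplace integrability)
  have ha_meas : AEStronglyMeasurable a (volume.restrict (Ioi 0)) := by
    have h1 : AEStronglyMeasurable (fun t => Real.exp (1 * t) * (Real.exp (-(1 * t)) * a t))
        (volume.restrict (Ioi 0)) :=
      (by fun_prop : Continuous fun t : ℝ => Real.exp (1 * t)).aestronglyMeasurable.mul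
        (hint 1 one_pos).aestronglyMeasurable
    refine h1.congr (Eventually.of_forall fun t => ?_)
    show Real.exp (1 * t) * (Real.exp (-(1 * t)) * a t) = a t
    rw [← mul_assoc, ← Real.exp_add, add_neg_cancel, Real.exp_zero, one_mul]
  rw [Metric.tendsto_nhds]
  intro ε hε
  have hη : (0 : ℝ) < ε / 3 := by positivity
  -- Widder's `T`: beyond it the bracket is `≤ (ε/3) t^γ`
  obtain ⟨T₀, hT₀⟩ := Filter.eventually_atTop.1 ((Metric.tendsto_nhds.1 hlim) (ε / 3) hη)
  obtain ⟨T, hT_eq⟩ : ∃ T : ℝ, max T₀ 1 = T := ⟨_, rfl⟩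
  have hT1 : 1 ≤ T := hT_eq ▸ le_max_right _ _
  have hTT₀ : T₀ ≤ T := hT_eq ▸ le_max_left _ _
  have hT0 : 0 < T := by linarith
  -- the bound `C` for the bracket on `(0, T]`
  obtain ⟨C, hC⟩ : ∃ C : ℝ, C = G * (∫ u in Ioc 0 T, |a u|) + |A| * T ^ γ := ⟨_, rfl⟩
  have hC0 : 0 ≤ C := by
    rw [hC]
    have : 0 ≤ ∫ u in Ioc 0 T, |a u| := integral_nonneg fun _ => abs_nonneg _
    positivity
  -- small `s`: `s^{γ+1} C T / G < ε/3`
  have hsmall : ∀ᶠ s in 𝓝[>] (0 : ℝ), s ^ (γ + 1) * (C * T / G) < ε / 3 := by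
    have hc : Tendsto (fun s : ℝ => s ^ (γ + 1) * (C * T / G)) (𝓝 0)
        (𝓝 ((0 : ℝ) ^ (γ + 1) * (C * T / G))) :=
      ((Real.continuous_rpow_const hγ1.le).tendsto 0).mul_const _
    rw [Real.zero_rpow hγ1.ne', zero_mul] at hc
    exact (tendsto_order.1 (tendsto_nhdsWithin_of_tendsto_nhds hc)).2 _ hη
  filter_upwards [self_mem_nhdsWithin, hsmall] with s hs hs_small
  replace hs : 0 < s := hs
  -- (i) `f(s) = s ∫ e^{-st} α(t) dt` and (ii) the Euler integral
  obtain ⟨hαint, hf_eq⟩ := wal_fubini hs ha_meas (hint s hs)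
  have hΓint := wal_gamma_integrableOn (γ := γ) hγ1 hs
  have hΓval := wal_gamma_integral (γ := γ) hγ1 hs
  rw [hG_eq] at hΓval
  have hP : 0 < s ^ (γ + 1) := Real.rpow_pos_of_pos hs _
  -- Widder's identity `s^γ f(s) − A = (s^{γ+1}/Γ(γ+1)) ∫ e^{-st} β(t) dt`
  have key : s ^ γ * (∫ t in Ioi 0, Real.exp (-(s * t)) * a t) - A =
      s ^ (γ + 1) / G * ∫ t in Ioi 0, Real.exp (-(s * t)) * β t := by
    have h1 : ∫ t in Ioi 0, Real.exp (-(s * t)) * β t =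
        G * (∫ t in Ioi 0, Real.exp (-(s * t)) * ∫ u in Ioc 0 t, a u) -
          A * (G / s ^ (γ + 1)) := by
      rw [← hΓval, ← integral_const_mul, ← integral_const_mul,
        ← integral_sub (hαint.const_mul G) (hΓint.const_mul A)]
      refine integral_congr_ae (Eventually.of_forall fun t => ?_)
      show Real.exp (-(s * t)) * β t =
        G * (Real.exp (-(s * t)) * ∫ u in Ioc 0 t, a u) - A * (Real.exp (-(s * t)) * t ^ γ)
      rw [hβ]
      ring
    rw [h1, hf_eq, Real.rpow_add_one hs.ne']
    have hsγ : s ^ γ ≠ 0 := (Real.rpow_pos_of_pos hs γ).ne'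
    field_simp
  -- the integrable majorant `C 1_{(0,T]} + (ε/3) e^{-st} t^γ` of `e^{-st} |β(t)|` on `(0,∞)`
  have hind : Integrable ((Ioc (0 : ℝ) T).indicator fun _ => C) (volume.restrict (Ioi (0 : ℝ))) := by
    refine Integrable.mono_measure ?_ Measure.restrict_le_self
    refine IntegrableOn.integrable_indicator ?_ measurableSet_Ioc
    exact integrableOn_const (measure_Ioc_lt_top).ne
  have hbound : ‖∫ t in Ioi 0, Real.exp (-(s * t)) * β t‖ ≤
      ∫ t in Ioi 0, ((Ioc (0 : ℝ) T).indicator (fun _ => C) t +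
        ε / 3 * (Real.exp (-(s * t)) * t ^ γ)) := by
    refine norm_integral_le_of_norm_le (hind.add (hΓint.const_mul _)) ?_
    refine (ae_restrict_mem measurableSet_Ioi).mono fun t ht => ?_
    replace ht : 0 < t := ht
    have e0 : 0 < Real.exp (-(s * t)) := Real.exp_pos _
    have hΓt : 0 ≤ ε / 3 * (Real.exp (-(s * t)) * t ^ γ) := by positivity
    show ‖Real.exp (-(s * t)) * β t‖ ≤
      (Ioc (0 : ℝ) T).indicator (fun _ => C) t + ε / 3 * (Real.exp (-(s * t)) * t ^ γ)
    rw [Real.norm_eq_abs, abs_mul, abs_of_pos e0]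
    rcases le_or_gt t T with htT | htT
    · -- `0 < t ≤ T`: the bracket is bounded by `C`
      have e1 : Real.exp (-(s * t)) ≤ 1 :=
        Real.exp_le_one_iff.mpr (by have := mul_pos hs ht; linarith)
      have hαt : |∫ u in Ioc 0 t, a u| ≤ ∫ u in Ioc 0 T, |a u| :=
        calc |∫ u in Ioc 0 t, a u| ≤ ∫ u in Ioc 0 t, |a u| := abs_integral_le_integral_abs
          _ ≤ ∫ u in Ioc 0 T, |a u| :=
            setIntegral_mono_set (hloc T).integrable.abs
              (Eventually.of_forall fun u => abs_nonneg (a u))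
              (Ioc_subset_Ioc_right htT).eventuallyLE
      have htγ : t ^ γ ≤ T ^ γ := Real.rpow_le_rpow ht.le htT hγ
      have hβt : |β t| ≤ C :=
        calc |β t| = |G * (∫ u in Ioc 0 t, a u) - A * t ^ γ| := by rw [hβ]
          _ ≤ |G * ∫ u in Ioc 0 t, a u| + |A * t ^ γ| := abs_sub _ _
          _ = G * |∫ u in Ioc 0 t, a u| + |A| * t ^ γ := by
            rw [abs_mul, abs_mul, abs_of_pos hG, abs_of_nonneg (Real.rpow_nonneg ht.le γ)]
          _ ≤ G * (∫ u in Ioc 0 T, |a u|) + |A| * T ^ γ :=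
            add_le_add (mul_le_mul_of_nonneg_left hαt hG.le)
              (mul_le_mul_of_nonneg_left htγ (abs_nonneg A))
          _ = C := hC.symm
      have hmem : t ∈ Ioc 0 T := ⟨ht, htT⟩
      rw [Set.indicator_of_mem hmem]
      calc Real.exp (-(s * t)) * |β t| ≤ 1 * C := mul_le_mul e1 hβt (abs_nonneg _) zero_le_one
        _ ≤ C + ε / 3 * (Real.exp (-(s * t)) * t ^ γ) := by linarith
    · -- `T < t`: the bracket is `≤ (ε/3) t^γ`
      have hd := hT₀ t (le_trans hTT₀ htT.le)
      rw [Real.dist_eq] at hd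
      have htγ : 0 < t ^ γ := Real.rpow_pos_of_pos ht γ
      have hβ' : (G * (∫ u in Ioc 0 t, a u) * t ^ (-γ) - A) * t ^ γ = β t := by
        rw [hβ, sub_mul, Real.rpow_neg ht.le, inv_mul_cancel_right₀ htγ.ne']
      have hβt : |β t| ≤ ε / 3 * t ^ γ := by
        rw [← hβ', abs_mul, abs_of_pos htγ]
        exact mul_le_mul_of_nonneg_right hd.le htγ.le
      have hnot : t ∉ Ioc 0 T := fun h => not_lt.mpr h.2 htT
      rw [Set.indicator_of_notMem hnot, zero_add]
      calc Real.exp (-(s * t)) * |β t| ≤ Real.exp (-(s * t)) * (ε / 3 * t ^ γ) :=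
            mul_le_mul_of_nonneg_left hβt e0.le
        _ = ε / 3 * (Real.exp (-(s * t)) * t ^ γ) := by ring
  have hmaj : ∫ t in Ioi 0, ((Ioc (0 : ℝ) T).indicator (fun _ => C) t +
      ε / 3 * (Real.exp (-(s * t)) * t ^ γ)) = C * T + ε / 3 * (G / s ^ (γ + 1)) := by
    rw [integral_add hind (hΓint.const_mul _), integral_const_mul, hΓval,
      setIntegral_indicator measurableSet_Ioc, inter_eq_right.mpr Ioc_subset_Ioi_self,
      setIntegral_const, smul_eq_mul, Real.volume_real_Ioc_of_le hT0.le]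
    ring
  -- conclusion
  rw [Real.dist_eq, key, abs_mul, abs_of_pos (div_pos hP hG)]
  have hI : |∫ t in Ioi 0, Real.exp (-(s * t)) * β t| ≤ C * T + ε / 3 * (G / s ^ (γ + 1)) := by
    rw [← hmaj, ← Real.norm_eq_abs]
    exact hbound
  calc s ^ (γ + 1) / G * |∫ t in Ioi 0, Real.exp (-(s * t)) * β t|
      ≤ s ^ (γ + 1) / G * (C * T + ε / 3 * (G / s ^ (γ + 1))) :=
        mul_le_mul_of_nonneg_left hI (div_pos hP hG).le
    _ = s ^ (γ + 1) * (C * T / G) + ε / 3 := by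
        field_simp
    _ < ε / 3 + ε / 3 := by linarith
    _ ≤ ε := by linarith

end Literature.Analysis.Asymptotics

end
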